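import Mathlib
import Summits.Schanuel.Schanuel.Theses.RigidCore
import Summits.Schanuel.Schanuel.Theses.GaussianStokesSector
import Summits.Schanuel.Schanuel.Theorems.AclSubsetLogFreeCore.Negative.LogFreeCoreCountable
import Literature.Barriers.Schanuel.AlgebraicIndependenceOfLogarithms
import Literature.Barriers.Schanuel.LargeTranscendenceDegreeSmallTrdegProofs
import Literature.NumberTheory.Transcendental.LindemannWeierstrassProofs
import Literature.NumberTheory.Transcendental.OneMotiveToricProofs

/-!
# Line `kernel-tower-relative-lw`: Schanuel over `L₀ = ℚ(π)^{ralg}` implies `PiFreeOverLWField`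

Registered stub `stub_piFreeOverLWField_of_schanuelOnStageZero` of line `kernel-tower-relative-lw`
of crux `stmt-Schanuel-0970` (`Summit.Schanuel.Schanuel.Theses.RigidCore.SchanuelOnLogFreeCore`,
(R) = Schanuel's conjecture for `ℚ`-linearly independent tuples from the log-free core
`C_EA = logFreeCore`).  The hypothesis `SC|_{L₀}` is Schanuel's statement for `ℚ`-linearly
independent tuples FROM `L₀ = stage 0 = ℚ(2πi)^{ralg} = ℚ(π)^{ralg}` (the first open layer of the
crux, `⟺ RelLW₀` by the landed `RigidCoreSchanuelOnLogFreeCoreRelLWZeroOfStageZero` and the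
skeleton's level-`0` sector split; implied by (R) along `stage 0 ≤ logFreeCore`).  The conclusion
is route GaussianStokesSector's crux `PiFreeOverLWField` (item stmt-Schanuel-9545): for every
`ℚ`-linearly independent family of algebraic numbers `a₁, …, a_d`,
`d + 1 ≤ trdeg_ℚ ℚ(π, e^{a₁}, …, e^{a_d})` — "`π` is transcendental over the Lindemann–Weierstrass
field".

Proof (`stub_piFreeOverLWField_of_schanuelOnStageZero`).  Fix algebraic, `ℚ`-linearly independent
`a : Fin d → ℂ` and put `x = (πi, a₁, …, a_d)`.
1. `x ⊂ L₀`: `πi = 2πi / 2 ∈ stage 0`, and each `aⱼ`, being algebraic over `ℚ`, is algebraic over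
   `ℚ(2πi)`, i.e. lies in `stage 0 = ℚ(2πi)^{ralg}`.
2. `x` is `ℚ`-linearly independent: a relation puts `πi` in `span_ℚ(a) ⊆ ℚ̄`, so `2πi = πi + πi`
   would be algebraic — contradicting Lindemann (`transcendental_two_pi_I`).
3. `SC|_{L₀}` at `x`: `d + 1 ≤ trdeg ℚ(x, e^x)`.
4. `ℚ(x, e^x) = ℚ(πi, a, e^{πi} = −1, e^a) ≤ ℚ({π} ∪ e^a ∪ ({i} ∪ a))`, and `i`, `aⱼ` are algebraic
   over `ℚ`, so the right-hand side has the transcendence degree of `ℚ(π, e^a)`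
   (`Literature.Barriers.Schanuel.trdeg_adjoin_union_eq_of_isAlgebraic`).  Hence
   `d + 1 ≤ trdeg ℚ(π, e^a)`.

Deliverables besides the stub (quotable cross-route edges):
* `KernelTower.piFreeOverLWField_of_schanuelOnLogFreeCore : (R) → PiFreeOverLWField` — crux
  stmt-Schanuel-0970 (RigidCore) implies crux stmt-Schanuel-9545 (GaussianStokesSector); a
  refutation of `PiFreeOverLWField` refutes (R) and Schanuel's conjecture;
* `KernelTower.algebraicIndependent_pi_exp_one_of_piFreeOverLWField` and
  `KernelTower.expOnePi_of_piFreeOverLWField` — the `d = 1`, `a = (1)` instance: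
  `PiFreeOverLWField` contains `e ⊥ π` (`ExpOnePiAlgebraicIndependent`, periods.S15, open);
* `KernelTower.algebraicIndependent_exp_over_stage_zero_of_piFreeOverLWField` — the converse on
  the algebraic sector: `PiFreeOverLWField` gives back the ALGEBRAIC instances of `RelLW₀`
  (for algebraic `ℚ`-free `u`, `e^u` is algebraically independent over `L₀`), by the tower law
  `trdeg ℚ(2πi, e^u, i) = trdeg ℚ(2πi) + trdeg_F F(e^u) ≤ 1 + trdeg_F F(e^u)` (`F = ℚ(2πi)`) and
  Mathlib's `AlgebraicIndependent.algebraicClosure`.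

Everything used is proved in the tree / Mathlib (Lindemann for `2πi`; field bookkeeping); the
Schanuel-type statements are HYPOTHESES, and `PiFreeOverLWField` (open) is obtained only as a
consequence.  No new definitions.
-/

noncomputable section

open IntermediateField
open Summit.Schanuel.Schanuel.Theorems.AclSubsetLogFreeCore.Negative

namespace Summit.Schanuel.Schanuel.Theorems.RigidCore

/-- **Registered stub `stub_piFreeOverLWField_of_schanuelOnStageZero` of line
`kernel-tower-relative-lw`** (signature verbatim) — `SC|_{L₀} ⟹ PiFreeOverLWField`: Schanuel's
statement for `ℚ`-linearly independent tuples from `L₀ = stage 0 = ℚ(π)^{ralg}` implies that `π`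
is transcendental over every Lindemann–Weierstrass field `ℚ(e^{a₁}, …, e^{a_d})` (`a` algebraic and
`ℚ`-free), with the Schanuel count `d + 1 ≤ trdeg ℚ(π, e^a)`: evaluate `SC|_{L₀}` at the `ℚ`-free
tuple `(πi, a₁, …, a_d) ⊂ L₀` and discard the algebraic generators `i, aⱼ` and `e^{πi} = −1`.
Cross-route edge from crux stmt-Schanuel-0970 (RigidCore) to crux stmt-Schanuel-9545
(GaussianStokesSector). [folklore] -/
theorem stub_piFreeOverLWField_of_schanuelOnStageZero :
    (∀ (n : ℕ) (x : Fin n → ℂ), (∀ i, x i ∈ stage 0) → LinearIndependent ℚ x →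
      (n : Cardinal) ≤ Algebra.trdeg ℚ ↥(adjoin ℚ (Set.range x ∪ Set.range (Complex.exp ∘ x)))) →
      Summit.Schanuel.Schanuel.Theses.GaussianStokesSector.PiFreeOverLWField := by
  intro hS0 d a ha hli
  -- algebraicity of `i` (used twice)
  have hI : IsAlgebraic ℚ Complex.I :=
    IsAlgebraic.of_pow two_pos (by rw [Complex.I_sq]; exact isAlgebraic_one.neg)
  -- (1) the tuple `x = (πi, a)` lies in `L₀ = stage 0`
  have hpiI : (Real.pi : ℂ) * Complex.I ∈ stage 0 := by
    have h := div_mem two_pi_I_mem_stage_zero (add_mem (one_mem (stage 0)) (one_mem (stage 0)))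
    have e : (2 * (Real.pi : ℂ) * Complex.I) / (1 + 1) = (Real.pi : ℂ) * Complex.I := by ring
    rwa [e] at h
  have hstage :
      ∀ i, (Fin.cons ((Real.pi : ℂ) * Complex.I) a : Fin (d + 1) → ℂ) i ∈ stage 0 := by
    intro i
    refine Fin.cases ?_ (fun j => ?_) i
    · rw [Fin.cons_zero]
      exact hpiI
    · rw [Fin.cons_succ]
      exact stage_closed 0 _ ((ha j).tower_top (L := ↥(stage 0)))
  -- (2) `x` is `ℚ`-linearly independent: a relation would make `πi`, hence `2πi`, algebraic
  have hxli :
      LinearIndependent ℚ (Fin.cons ((Real.pi : ℂ) * Complex.I) a : Fin (d + 1) → ℂ) := by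
    refine hli.finCons fun hmem => ?_
    have hsub : Set.range a ⊆
        (Subalgebra.toSubmodule (algebraicClosure ℚ ℂ).toSubalgebra : Set ℂ) := by
      rintro _ ⟨j, rfl⟩
      exact mem_algebraicClosure_iff.mpr (ha j)
    have halg : IsAlgebraic ℚ ((Real.pi : ℂ) * Complex.I) :=
      mem_algebraicClosure_iff.mp (Submodule.span_le.mpr hsub hmem)
    refine Literature.NumberTheory.Transcendental.transcendental_two_pi_I ?_
    have e : (2 * Real.pi * Complex.I : ℂ) =
        (Real.pi : ℂ) * Complex.I + (Real.pi : ℂ) * Complex.I := by ring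
    rw [e]
    exact halg.add halg
  -- (3) Schanuel over `L₀` at `x`
  have hSx := hS0 (d + 1) (Fin.cons ((Real.pi : ℂ) * Complex.I) a) hstage hxli
  -- (4) `ℚ(x, e^x) ≤ ℚ({π} ∪ e^a ∪ ({i} ∪ a))` (`πi = π·i`, `e^{πi} = −1`)
  have hle :
      adjoin ℚ (Set.range (Fin.cons ((Real.pi : ℂ) * Complex.I) a : Fin (d + 1) → ℂ) ∪
          Set.range
            (Complex.exp ∘ (Fin.cons ((Real.pi : ℂ) * Complex.I) a : Fin (d + 1) → ℂ))) ≤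
        adjoin ℚ (insert (Real.pi : ℂ) (Set.range (Complex.exp ∘ a)) ∪
          insert Complex.I (Set.range a)) := by
    rw [adjoin_le_iff]
    rintro z (⟨i, rfl⟩ | ⟨i, rfl⟩)
    · refine Fin.cases ?_ (fun j => ?_) i
      · rw [Fin.cons_zero]
        exact mul_mem (subset_adjoin ℚ _ (Or.inl (Set.mem_insert _ _)))
          (subset_adjoin ℚ _ (Or.inr (Set.mem_insert _ _)))
      · rw [Fin.cons_succ]
        exact subset_adjoin ℚ _ (Or.inr (Set.mem_insert_of_mem _ ⟨j, rfl⟩))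
    · refine Fin.cases ?_ (fun j => ?_) i
      · rw [Function.comp_apply, Fin.cons_zero, Complex.exp_pi_mul_I]
        exact neg_mem (one_mem _)
      · rw [Function.comp_apply, Fin.cons_succ]
        exact subset_adjoin ℚ _ (Or.inl (Set.mem_insert_of_mem _ ⟨j, rfl⟩))
  -- (5) the generators `i, aⱼ` are algebraic over `ℚ`: drop them
  have hT : ∀ z ∈ insert Complex.I (Set.range a), IsAlgebraic ℚ z := by
    rintro z (rfl | ⟨j, rfl⟩)
    · exact hI
    · exact ha j
  calc ((d + 1 : ℕ) : Cardinal)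
      ≤ Algebra.trdeg ℚ ↥(adjoin ℚ
          (Set.range (Fin.cons ((Real.pi : ℂ) * Complex.I) a : Fin (d + 1) → ℂ) ∪
            Set.range
              (Complex.exp ∘ (Fin.cons ((Real.pi : ℂ) * Complex.I) a : Fin (d + 1) → ℂ)))) := hSx
    _ ≤ Algebra.trdeg ℚ ↥(adjoin ℚ (insert (Real.pi : ℂ) (Set.range (Complex.exp ∘ a)) ∪
          insert Complex.I (Set.range a))) :=
        trdeg_le_of_injective (inclusion hle) (inclusion_injective hle)
    _ = Algebra.trdeg ℚ ↥(adjoin ℚ (insert (Real.pi : ℂ) (Set.range (Complex.exp ∘ a)))) :=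
        Literature.Barriers.Schanuel.trdeg_adjoin_union_eq_of_isAlgebraic _ _ hT

/-- **Cross-route edge `(R) ⟹ PiFreeOverLWField`**: crux stmt-Schanuel-0970 (RigidCore,
`SchanuelOnLogFreeCore`) implies crux stmt-Schanuel-9545 (GaussianStokesSector,
`PiFreeOverLWField`); a refutation of `PiFreeOverLWField` refutes (R) and Schanuel's conjecture.
Composition of `stub_piFreeOverLWField_of_schanuelOnStageZero` with the restriction
`(R) ⟹ SC|_{L₀}` along `stage 0 ≤ logFreeCore` (`stage_le_of_mem logFreeCore_mem_coreFamily 0`;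
the crux unfolds to membership in `logFreeCore = sInf coreFamily` definitionally). [folklore] -/
theorem KernelTower.piFreeOverLWField_of_schanuelOnLogFreeCore :
    Summit.Schanuel.Schanuel.Theses.RigidCore.SchanuelOnLogFreeCore →
      Summit.Schanuel.Schanuel.Theses.GaussianStokesSector.PiFreeOverLWField := by
  intro hR
  refine stub_piFreeOverLWField_of_schanuelOnStageZero fun n x hx hli => ?_
  exact hR n x (fun i => stage_le_of_mem logFreeCore_mem_coreFamily 0 (hx i)) hli

/-- **`PiFreeOverLWField` contains `e ⊥ π`** (its `d = 1`, `a = (1)` instance, complex form):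
`2 ≤ trdeg ℚ(π, e^1)` and `ℚ(π, e^1)` is generated by the pair `(π, e)`, so the pair is
algebraically independent over `ℚ`
(`Literature.Barriers.Schanuel.algebraicIndependent_of_le_trdeg_adjoin`). [folklore] -/
theorem KernelTower.algebraicIndependent_pi_exp_one_of_piFreeOverLWField :
    Summit.Schanuel.Schanuel.Theses.GaussianStokesSector.PiFreeOverLWField →
      AlgebraicIndependent ℚ ![(Real.pi : ℂ), Complex.exp 1] := by
  intro h
  have h1 := h 1 (fun _ => 1) (fun _ => isAlgebraic_one)
    ((linearIndependent_unique_iff (v := fun _ : Fin 1 => (1 : ℂ))).mpr one_ne_zero)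
  have hle : adjoin ℚ (insert (Real.pi : ℂ) (Set.range (Complex.exp ∘ fun _ : Fin 1 => (1 : ℂ)))) ≤
      adjoin ℚ (Set.range ![(Real.pi : ℂ), Complex.exp 1]) := by
    refine adjoin.mono ℚ _ _ (Set.insert_subset_iff.mpr ⟨⟨0, rfl⟩, ?_⟩)
    rintro _ ⟨j, rfl⟩
    exact ⟨1, rfl⟩
  exact Literature.Barriers.Schanuel.algebraicIndependent_of_le_trdeg_adjoin _
    (h1.trans (trdeg_le_of_injective (inclusion hle) (inclusion_injective hle)))

/-- **`PiFreeOverLWField ⟹ ExpOnePiAlgebraicIndependent`** (the tree's registered open statement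
periods.S15, `e` and `π` algebraically independent over `ℚ` as real numbers): from the complex
form `KernelTower.algebraicIndependent_pi_exp_one_of_piFreeOverLWField` along `ℝ ↪ ℂ`. So a proof
of crux stmt-Schanuel-9545 would in particular settle `e ⊥ π`. [folklore] -/
theorem KernelTower.expOnePi_of_piFreeOverLWField :
    Summit.Schanuel.Schanuel.Theses.GaussianStokesSector.PiFreeOverLWField →
      Literature.NumberTheory.Transcendental.ExpOnePiAlgebraicIndependent := by
  intro h
  have hC := KernelTower.algebraicIndependent_pi_exp_one_of_piFreeOverLWField h
  -- reorder to `(e, π)` and descend to `ℝ` along `ofReal`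
  have hC' : AlgebraicIndependent ℚ ![Complex.exp 1, (Real.pi : ℂ)] := by
    have hfun : ![Complex.exp 1, (Real.pi : ℂ)] =
        ![(Real.pi : ℂ), Complex.exp 1] ∘ ⇑(Equiv.swap (0 : Fin 2) 1) := by
      funext i
      fin_cases i <;> rfl
    rw [hfun]
    exact hC.comp _ (Equiv.injective _)
  refine AlgebraicIndependent.of_comp (Complex.ofRealAm.restrictScalars ℚ) ?_
  have hfun : ⇑(Complex.ofRealAm.restrictScalars ℚ) ∘ ![Real.exp 1, Real.pi] =
      ![Complex.exp 1, (Real.pi : ℂ)] := by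
    funext i
    fin_cases i <;> simp [Complex.ofReal_exp]
  rw [hfun]
  exact hC'

/-- **Converse on the algebraic sector: `PiFreeOverLWField` gives back the algebraic instances of
`RelLW₀`.** For algebraic, `ℚ`-linearly independent `u : Fin r → ℂ`, the exponentials `e^u` are
algebraically independent over `L₀ = stage 0 = ℚ(2πi)^{ralg}`: `PiFreeOverLWField` gives
`r + 1 ≤ trdeg ℚ(π, e^u) ≤ trdeg ℚ(2πi, e^u, i) = trdeg ℚ(2πi, e^u)` (`i` algebraic)
`= trdeg ℚ(2πi) + trdeg_F F(e^u) ≤ 1 + trdeg_F F(e^u)` for `F = ℚ(2πi)` (tower law `trdeg_add_eq`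
along `ℚ ⊆ F ⊆ F(e^u) = ℚ(2πi, e^u)`), so `r ≤ trdeg_F F(e^u)`, `e^u` is algebraically independent
over `F` (`Literature.Barriers.Schanuel.algebraicIndependent_of_le_trdeg_adjoin`) and hence over
the algebraic extension `L₀ = F^{ralg}` (Mathlib `AlgebraicIndependent.algebraicClosure`).  (For
algebraic `u`, `ℚ`-linear independence is the same as independence modulo `ℚ·2πi`, so these are
exactly the instances of `RelLW₀` with algebraic exponents; together with
`stub_piFreeOverLWField_of_schanuelOnStageZero`: on the algebraic sector, `RelLW₀`, `SC|_{L₀}` and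
`PiFreeOverLWField` agree.) [folklore] -/
theorem KernelTower.algebraicIndependent_exp_over_stage_zero_of_piFreeOverLWField :
    Summit.Schanuel.Schanuel.Theses.GaussianStokesSector.PiFreeOverLWField →
      ∀ (r : ℕ) (u : Fin r → ℂ), (∀ i, IsAlgebraic ℚ (u i)) → LinearIndependent ℚ u →
        AlgebraicIndependent (↥(stage 0)) (fun i => Complex.exp (u i)) := by
  intro h r u hu hli
  -- (0) the counting step, in pure field theory (generic base field `K`): if `L` with
  -- `r + 1 ≤ trdeg_K L` lies in `K(S ∪ T ∪ U)`, `U` is algebraic over `K` and `trdeg_K K(S) ≤ 1`,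
  -- then `r ≤ trdeg_{K(S)} K(S)(T)`
  have hcount_of : ∀ {K E : Type} [Field K] [Field E] [Algebra K E] (S T U : Set E)
      {L : IntermediateField K E}, (r : Cardinal) + 1 ≤ Algebra.trdeg K L →
        L ≤ adjoin K ((S ∪ T) ∪ U) → (∀ a ∈ U, IsAlgebraic K a) →
          Algebra.trdeg K ↥(adjoin K S) ≤ 1 →
            (r : Cardinal) ≤ Algebra.trdeg ↥(adjoin K S) ↥(adjoin (↥(adjoin K S)) T) := by
    intro K E _ _ _ S T U L hr hL hU hS
    -- tower law `trdeg_K K(S ∪ T) = trdeg_K K(S) + trdeg_{K(S)} K(S)(T)` (`trdeg_add_eq` along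
    -- `K ⊆ K(S) ⊆ K(S)(T) = K(S ∪ T)`, `adjoin_adjoin_left`)
    haveI : FaithfulSMul (↥(adjoin K S)) (↥(adjoin (↥(adjoin K S)) T)) :=
      (faithfulSMul_iff_algebraMap_injective _ _).mpr
        (algebraMap (↥(adjoin K S)) (↥(adjoin (↥(adjoin K S)) T))).injective
    have htower := trdeg_add_eq K (adjoin K S) (A := adjoin (adjoin K S) T)
    have heq : Algebra.trdeg K (adjoin (adjoin K S) T) = Algebra.trdeg K (adjoin K (S ∪ T)) := by
      rw [← (equivOfEq (adjoin_adjoin_left K S T)).trdeg_eq]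
      rfl
    have hST : Algebra.trdeg K ↥(adjoin K (S ∪ T)) = Algebra.trdeg K ↥(adjoin K S) +
        Algebra.trdeg ↥(adjoin K S) ↥(adjoin (↥(adjoin K S)) T) := by
      rw [← heq, ← htower]
    rw [← Cardinal.add_one_le_add_one_iff]
    calc (r : Cardinal) + 1 ≤ Algebra.trdeg K L := hr
      _ ≤ Algebra.trdeg K ↥(adjoin K ((S ∪ T) ∪ U)) := Literature.Barriers.Schanuel.trdeg_mono hL
      _ = Algebra.trdeg K ↥(adjoin K (S ∪ T)) :=
          Literature.Barriers.Schanuel.trdeg_adjoin_union_eq_of_isAlgebraic _ _ hU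
      _ = Algebra.trdeg K ↥(adjoin K S) +
            Algebra.trdeg ↥(adjoin K S) ↥(adjoin (↥(adjoin K S)) T) := hST
      _ ≤ 1 + Algebra.trdeg ↥(adjoin K S) ↥(adjoin (↥(adjoin K S)) T) := add_le_add hS le_rfl
      _ = Algebra.trdeg ↥(adjoin K S) ↥(adjoin (↥(adjoin K S)) T) + 1 := add_comm _ _
  -- (1) `PiFreeOverLWField` at `u`: `r + 1 ≤ trdeg ℚ(π, e^u)`
  have hr := h r u hu hli
  -- (2) `ℚ(π, e^u) ≤ ℚ(2πi, e^u, i)` (`π = 2πi / (i + i)`)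
  have hle : adjoin ℚ (insert (Real.pi : ℂ) (Set.range (Complex.exp ∘ u))) ≤
      adjoin ℚ (((({(2 * (Real.pi : ℂ) * Complex.I)} : Set ℂ) ∪
        Set.range fun i => Complex.exp (u i)) ∪ {Complex.I})) := by
    rw [adjoin_le_iff]
    rintro z (rfl | ⟨j, rfl⟩)
    · have e : (2 * (Real.pi : ℂ) * Complex.I) / (Complex.I + Complex.I) = (Real.pi : ℂ) := by
        rw [← two_mul, show (2 * (Real.pi : ℂ) * Complex.I) = (Real.pi : ℂ) * (2 * Complex.I) by
          ring]
        exact mul_div_cancel_right₀ _ (mul_ne_zero two_ne_zero Complex.I_ne_zero)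
      have hmem := div_mem (subset_adjoin ℚ ((({(2 * (Real.pi : ℂ) * Complex.I)} : Set ℂ) ∪
          Set.range fun i => Complex.exp (u i)) ∪ {Complex.I}) (Or.inl (Or.inl rfl)))
        (add_mem (subset_adjoin ℚ _ (Or.inr rfl)) (subset_adjoin ℚ _ (Or.inr rfl)))
      rwa [e] at hmem
    · exact subset_adjoin ℚ _ (Or.inl (Or.inr ⟨j, rfl⟩))
  -- (3) `i` is algebraic over `ℚ`
  have hU : ∀ z ∈ ({Complex.I} : Set ℂ), IsAlgebraic ℚ z := by
    intro z hz
    rw [Set.mem_singleton_iff.mp hz]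
    exact IsAlgebraic.of_pow two_pos (by rw [Complex.I_sq]; exact isAlgebraic_one.neg)
  -- (4) count (`trdeg_ℚ ℚ(2πi) ≤ 1`) and conclude over `F = ℚ(2πi)`, then over `L₀ = F^{ralg}`
  have hcount := hcount_of (K := ℚ) ({(2 * (Real.pi : ℂ) * Complex.I)} : Set ℂ)
    (Set.range fun i => Complex.exp (u i)) ({Complex.I} : Set ℂ)
    (by rw [← Nat.cast_add_one]; exact hr) hle hU
    (Literature.Barriers.Schanuel.trdeg_adjoin_singleton_le_one _)
  exact (Literature.Barriers.Schanuel.algebraicIndependent_of_le_trdeg_adjoin _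
    hcount).algebraicClosure

end Summit.Schanuel.Schanuel.Theorems.RigidCore

end
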